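import Mathlib
import HarnessLib
import Summits.AtomisticToContinuum.Crystallization.Theorems.FrustratedLawDichotomyAperiodicFrustratedLawGapErgodicCampbellWeight

/-!
# Ergodic reduction for the crux `AperiodicFrustratedLawGap` — the weighted Campbell space as a dynamical system

Route `FrustratedLawDichotomy`, crux `AperiodicFrustratedLawGap` (item `stmt-AtomisticToContinuum-27623`),
registered stub `stub_ergodicReduction` (skeleton `dd3251ad731e`); seventh brick of step D5 (`hErg`; evidence
`D5-PLAN.md`, steps "Refinement of D5c" and S1).  Packaging for the Hilbert-space step: with
`π = (ν ⊗ₘ κ₀).withDensity W`, `W(S,y) = w(y) + (1 − Σ_z w(z)) 1[y=0]`,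

* `measurePreserving_reroot_campbell` — the re-rooting involution `Θ` is `π`-preserving (so `h ↦ h ∘ Θ` is a
  unitary of `L²(π)`, `MeasureTheory.Lp.compMeasurePreservingₗᵢ`);
* `measurePreserving_fst_campbell` — `p₁ : (X × ℝ³, π) → (X, ν)` is measure preserving (so `f ↦ f ∘ p₁` is an
  isometry `L²(ν) → L²(π)`); `isFiniteMeasure_campbell` — `π` is finite when `ν` is;
* `ae_campbell_iff` — for an everywhere-positive weight, `π` and `ν ⊗ₘ κ₀` have the same null sets;
* `exists_invariant_ae_eq_of_campbell` — a measurable `h` with `h(S − y) = h(S)` for `π`-a.e. `(S, y)` is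
  `ν`-a.e. equal to an EXACTLY invariant measurable function (the fixed space of `E† U E` consists of invariant
  functions).

`[folklore]`.
-/

noncomputable section

namespace Summit.AtomisticToContinuum.Crystallization.Theorems.FrustratedLawDichotomyErgodicReduction

open MeasureTheory Set Filter ProbabilityTheory
open scoped ENNReal Classical
open Literature.Probability.Process (LocalConfig)
open Literature.Probability.Process.LocalConfig (RootedHardCoreConfig toMeasure_def measurable_toMeasure)
open Summit.AtomisticToContinuum.Crystallization.Theorems.BenjaminiSchrammLimit (isSFiniteKernel_toMeasure
  measurable_reroot)

variable {δ : ℝ}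

/-- **`Θ` preserves the weighted Campbell measure** (`δ > 0`, `ν` s-finite with `Θ`-invariant Campbell
measure, `w` measurable even). [folklore] -/
theorem measurePreserving_reroot_campbell [Fact (0 < δ)]
    {ν : Measure (RootedHardCoreConfig (EuclideanSpace ℝ (Fin 3)) δ)} [SFinite ν]
    (hinv : haveI := isSFiniteKernel_toMeasure (E := EuclideanSpace ℝ (Fin 3)) (δ := δ)
      (ν ⊗ₘ (⟨fun S : RootedHardCoreConfig (EuclideanSpace ℝ (Fin 3)) δ =>
        (S.1 : LocalConfig (EuclideanSpace ℝ (Fin 3))).toMeasure,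
        measurable_toMeasure (Fact.out : 0 < δ)⟩ :
        Kernel (RootedHardCoreConfig (EuclideanSpace ℝ (Fin 3)) δ) (EuclideanSpace ℝ (Fin 3)))).map
      (fun p : RootedHardCoreConfig (EuclideanSpace ℝ (Fin 3)) δ × EuclideanSpace ℝ (Fin 3) =>
        ((if h : p.2 ∈ ((p.1.1 : LocalConfig (EuclideanSpace ℝ (Fin 3))) : Set (EuclideanSpace ℝ (Fin 3)))
          then p.1.reroot p.2 h else p.1 : RootedHardCoreConfig (EuclideanSpace ℝ (Fin 3)) δ), -p.2)) =
      ν ⊗ₘ (⟨fun S : RootedHardCoreConfig (EuclideanSpace ℝ (Fin 3)) δ =>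
        (S.1 : LocalConfig (EuclideanSpace ℝ (Fin 3))).toMeasure,
        measurable_toMeasure (Fact.out : 0 < δ)⟩ :
        Kernel (RootedHardCoreConfig (EuclideanSpace ℝ (Fin 3)) δ) (EuclideanSpace ℝ (Fin 3))))
    {w : EuclideanSpace ℝ (Fin 3) → ℝ≥0∞} (hw : Measurable w) (hws : ∀ y, w (-y) = w y) :
    haveI := isSFiniteKernel_toMeasure (E := EuclideanSpace ℝ (Fin 3)) (δ := δ)
    MeasurePreserving
      (fun p : RootedHardCoreConfig (EuclideanSpace ℝ (Fin 3)) δ × EuclideanSpace ℝ (Fin 3) =>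
        ((if h : p.2 ∈ ((p.1.1 : LocalConfig (EuclideanSpace ℝ (Fin 3))) : Set (EuclideanSpace ℝ (Fin 3)))
          then p.1.reroot p.2 h else p.1 : RootedHardCoreConfig (EuclideanSpace ℝ (Fin 3)) δ), -p.2))
      ((ν ⊗ₘ (⟨fun S : RootedHardCoreConfig (EuclideanSpace ℝ (Fin 3)) δ =>
          (S.1 : LocalConfig (EuclideanSpace ℝ (Fin 3))).toMeasure,
          measurable_toMeasure (Fact.out : 0 < δ)⟩ :
          Kernel (RootedHardCoreConfig (EuclideanSpace ℝ (Fin 3)) δ) (EuclideanSpace ℝ (Fin 3)))).withDensity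
        (fun p : RootedHardCoreConfig (EuclideanSpace ℝ (Fin 3)) δ × EuclideanSpace ℝ (Fin 3) =>
          w p.2 + (1 - ∫⁻ z, w z ∂((p.1.1 : LocalConfig (EuclideanSpace ℝ (Fin 3))).toMeasure)) *
            ({(0 : EuclideanSpace ℝ (Fin 3))} : Set (EuclideanSpace ℝ (Fin 3))).indicator
              (fun _ => (1 : ℝ≥0∞)) p.2))
      ((ν ⊗ₘ (⟨fun S : RootedHardCoreConfig (EuclideanSpace ℝ (Fin 3)) δ =>
          (S.1 : LocalConfig (EuclideanSpace ℝ (Fin 3))).toMeasure,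
          measurable_toMeasure (Fact.out : 0 < δ)⟩ :
          Kernel (RootedHardCoreConfig (EuclideanSpace ℝ (Fin 3)) δ) (EuclideanSpace ℝ (Fin 3)))).withDensity
        (fun p : RootedHardCoreConfig (EuclideanSpace ℝ (Fin 3)) δ × EuclideanSpace ℝ (Fin 3) =>
          w p.2 + (1 - ∫⁻ z, w z ∂((p.1.1 : LocalConfig (EuclideanSpace ℝ (Fin 3))).toMeasure)) *
            ({(0 : EuclideanSpace ℝ (Fin 3))} : Set (EuclideanSpace ℝ (Fin 3))).indicator
              (fun _ => (1 : ℝ≥0∞)) p.2)) :=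
  ⟨measurable_reroot Fact.out, map_reroot_withDensity_campbellWeight hinv hw hws⟩

/-- **The first projection is measure preserving** from the weighted Campbell measure to the law (`δ > 0`,
weight of mass `≤ 1` on every configuration). [folklore] -/
theorem measurePreserving_fst_campbell [Fact (0 < δ)]
    (ν : Measure (RootedHardCoreConfig (EuclideanSpace ℝ (Fin 3)) δ)) [SFinite ν]
    {w : EuclideanSpace ℝ (Fin 3) → ℝ≥0∞} (hw : Measurable w)
    (hw1 : ∀ S : RootedHardCoreConfig (EuclideanSpace ℝ (Fin 3)) δ,
      ∫⁻ y, w y ∂((S.1 : LocalConfig (EuclideanSpace ℝ (Fin 3))).toMeasure) ≤ 1) :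
    haveI := isSFiniteKernel_toMeasure (E := EuclideanSpace ℝ (Fin 3)) (δ := δ)
    MeasurePreserving (Prod.fst : RootedHardCoreConfig (EuclideanSpace ℝ (Fin 3)) δ × EuclideanSpace ℝ (Fin 3) →
        RootedHardCoreConfig (EuclideanSpace ℝ (Fin 3)) δ)
      ((ν ⊗ₘ (⟨fun S : RootedHardCoreConfig (EuclideanSpace ℝ (Fin 3)) δ =>
          (S.1 : LocalConfig (EuclideanSpace ℝ (Fin 3))).toMeasure,
          measurable_toMeasure (Fact.out : 0 < δ)⟩ :
          Kernel (RootedHardCoreConfig (EuclideanSpace ℝ (Fin 3)) δ) (EuclideanSpace ℝ (Fin 3)))).withDensity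
        (fun p : RootedHardCoreConfig (EuclideanSpace ℝ (Fin 3)) δ × EuclideanSpace ℝ (Fin 3) =>
          w p.2 + (1 - ∫⁻ z, w z ∂((p.1.1 : LocalConfig (EuclideanSpace ℝ (Fin 3))).toMeasure)) *
            ({(0 : EuclideanSpace ℝ (Fin 3))} : Set (EuclideanSpace ℝ (Fin 3))).indicator
              (fun _ => (1 : ℝ≥0∞)) p.2)) ν :=
  ⟨measurable_fst, map_fst_withDensity_campbellWeight ν hw hw1⟩

/-- The weighted Campbell measure of a finite law is finite (its total mass is that of the law). [folklore] -/
theorem isFiniteMeasure_campbell [Fact (0 < δ)]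
    (ν : Measure (RootedHardCoreConfig (EuclideanSpace ℝ (Fin 3)) δ)) [IsFiniteMeasure ν]
    {w : EuclideanSpace ℝ (Fin 3) → ℝ≥0∞} (hw : Measurable w)
    (hw1 : ∀ S : RootedHardCoreConfig (EuclideanSpace ℝ (Fin 3)) δ,
      ∫⁻ y, w y ∂((S.1 : LocalConfig (EuclideanSpace ℝ (Fin 3))).toMeasure) ≤ 1) :
    haveI := isSFiniteKernel_toMeasure (E := EuclideanSpace ℝ (Fin 3)) (δ := δ)
    IsFiniteMeasure
      (((ν ⊗ₘ (⟨fun S : RootedHardCoreConfig (EuclideanSpace ℝ (Fin 3)) δ =>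
          (S.1 : LocalConfig (EuclideanSpace ℝ (Fin 3))).toMeasure,
          measurable_toMeasure (Fact.out : 0 < δ)⟩ :
          Kernel (RootedHardCoreConfig (EuclideanSpace ℝ (Fin 3)) δ) (EuclideanSpace ℝ (Fin 3)))).withDensity
        (fun p : RootedHardCoreConfig (EuclideanSpace ℝ (Fin 3)) δ × EuclideanSpace ℝ (Fin 3) =>
          w p.2 + (1 - ∫⁻ z, w z ∂((p.1.1 : LocalConfig (EuclideanSpace ℝ (Fin 3))).toMeasure)) *
            ({(0 : EuclideanSpace ℝ (Fin 3))} : Set (EuclideanSpace ℝ (Fin 3))).indicator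
              (fun _ => (1 : ℝ≥0∞)) p.2))) := by
  haveI := isSFiniteKernel_toMeasure (E := EuclideanSpace ℝ (Fin 3)) (δ := δ)
  refine ⟨?_⟩
  have h := (measurePreserving_fst_campbell ν hw hw1).measure_preimage MeasurableSet.univ.nullMeasurableSet
  rw [preimage_univ] at h
  rw [h]
  exact measure_lt_top ν _

/-- **The weighted Campbell measure has the null sets of the Campbell measure** when the weight is positive
everywhere (`w(y) ≠ 0` for all `y`). [folklore] -/
theorem ae_campbell_iff [Fact (0 < δ)]
    (ν : Measure (RootedHardCoreConfig (EuclideanSpace ℝ (Fin 3)) δ)) [SFinite ν]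
    {w : EuclideanSpace ℝ (Fin 3) → ℝ≥0∞} (hw : Measurable w) (hw0 : ∀ y, w y ≠ 0)
    {p : RootedHardCoreConfig (EuclideanSpace ℝ (Fin 3)) δ × EuclideanSpace ℝ (Fin 3) → Prop} :
    haveI := isSFiniteKernel_toMeasure (E := EuclideanSpace ℝ (Fin 3)) (δ := δ)
    (∀ᵐ q ∂(((ν ⊗ₘ (⟨fun S : RootedHardCoreConfig (EuclideanSpace ℝ (Fin 3)) δ =>
          (S.1 : LocalConfig (EuclideanSpace ℝ (Fin 3))).toMeasure,
          measurable_toMeasure (Fact.out : 0 < δ)⟩ :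
          Kernel (RootedHardCoreConfig (EuclideanSpace ℝ (Fin 3)) δ) (EuclideanSpace ℝ (Fin 3)))).withDensity
        (fun p : RootedHardCoreConfig (EuclideanSpace ℝ (Fin 3)) δ × EuclideanSpace ℝ (Fin 3) =>
          w p.2 + (1 - ∫⁻ z, w z ∂((p.1.1 : LocalConfig (EuclideanSpace ℝ (Fin 3))).toMeasure)) *
            ({(0 : EuclideanSpace ℝ (Fin 3))} : Set (EuclideanSpace ℝ (Fin 3))).indicator
              (fun _ => (1 : ℝ≥0∞)) p.2))), p q) ↔
      ∀ᵐ q ∂(ν ⊗ₘ (⟨fun S : RootedHardCoreConfig (EuclideanSpace ℝ (Fin 3)) δ =>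
          (S.1 : LocalConfig (EuclideanSpace ℝ (Fin 3))).toMeasure,
          measurable_toMeasure (Fact.out : 0 < δ)⟩ :
          Kernel (RootedHardCoreConfig (EuclideanSpace ℝ (Fin 3)) δ) (EuclideanSpace ℝ (Fin 3)))), p q := by
  haveI := isSFiniteKernel_toMeasure (E := EuclideanSpace ℝ (Fin 3)) (δ := δ)
  have hW : Measurable (fun p : RootedHardCoreConfig (EuclideanSpace ℝ (Fin 3)) δ × EuclideanSpace ℝ (Fin 3) =>
      w p.2 + (1 - ∫⁻ z, w z ∂((p.1.1 : LocalConfig (EuclideanSpace ℝ (Fin 3))).toMeasure)) *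
        ({(0 : EuclideanSpace ℝ (Fin 3))} : Set (EuclideanSpace ℝ (Fin 3))).indicator (fun _ => (1 : ℝ≥0∞)) p.2) :=
    (hw.comp measurable_snd).add ((measurable_const.sub ((measurable_lintegral_weight hw).comp measurable_fst)).mul
      ((measurable_const.indicator (measurableSet_singleton 0)).comp measurable_snd))
  rw [ae_withDensity_iff hW]
  refine ⟨fun h => h.mono fun q hq => hq ?_, fun h => h.mono fun q hq _ => hq⟩
  exact ne_of_gt (lt_of_lt_of_le (pos_iff_ne_zero.2 (hw0 q.2)) le_self_add)

/-- **Functions invariant along `π`-almost every edge are `ν`-a.e. exactly invariant** (`δ > 0`; `ν` with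
`Θ`-invariant Campbell measure; `w` measurable and positive everywhere): the function-level content of
"the fixed space of `E† U E` consists of re-rooting-invariant functions". [folklore] -/
theorem exists_invariant_ae_eq_of_campbell [Fact (0 < δ)] {β : Type*} [MeasurableSpace β] [MeasurableEq β]
    [Nonempty β]
    {ν : Measure (RootedHardCoreConfig (EuclideanSpace ℝ (Fin 3)) δ)} [SFinite ν]
    (hinv : haveI := isSFiniteKernel_toMeasure (E := EuclideanSpace ℝ (Fin 3)) (δ := δ)
      (ν ⊗ₘ (⟨fun S : RootedHardCoreConfig (EuclideanSpace ℝ (Fin 3)) δ =>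
        (S.1 : LocalConfig (EuclideanSpace ℝ (Fin 3))).toMeasure,
        measurable_toMeasure (Fact.out : 0 < δ)⟩ :
        Kernel (RootedHardCoreConfig (EuclideanSpace ℝ (Fin 3)) δ) (EuclideanSpace ℝ (Fin 3)))).map
      (fun p : RootedHardCoreConfig (EuclideanSpace ℝ (Fin 3)) δ × EuclideanSpace ℝ (Fin 3) =>
        ((if h : p.2 ∈ ((p.1.1 : LocalConfig (EuclideanSpace ℝ (Fin 3))) : Set (EuclideanSpace ℝ (Fin 3)))
          then p.1.reroot p.2 h else p.1 : RootedHardCoreConfig (EuclideanSpace ℝ (Fin 3)) δ), -p.2)) =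
      ν ⊗ₘ (⟨fun S : RootedHardCoreConfig (EuclideanSpace ℝ (Fin 3)) δ =>
        (S.1 : LocalConfig (EuclideanSpace ℝ (Fin 3))).toMeasure,
        measurable_toMeasure (Fact.out : 0 < δ)⟩ :
        Kernel (RootedHardCoreConfig (EuclideanSpace ℝ (Fin 3)) δ) (EuclideanSpace ℝ (Fin 3))))
    {w : EuclideanSpace ℝ (Fin 3) → ℝ≥0∞} (hw : Measurable w) (hw0 : ∀ y, w y ≠ 0)
    {f : RootedHardCoreConfig (EuclideanSpace ℝ (Fin 3)) δ → β} (hf : Measurable f)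
    (hae : ∀ᵐ q ∂(haveI := isSFiniteKernel_toMeasure (E := EuclideanSpace ℝ (Fin 3)) (δ := δ)
      ((ν ⊗ₘ (⟨fun S : RootedHardCoreConfig (EuclideanSpace ℝ (Fin 3)) δ =>
          (S.1 : LocalConfig (EuclideanSpace ℝ (Fin 3))).toMeasure,
          measurable_toMeasure (Fact.out : 0 < δ)⟩ :
          Kernel (RootedHardCoreConfig (EuclideanSpace ℝ (Fin 3)) δ) (EuclideanSpace ℝ (Fin 3)))).withDensity
        (fun p : RootedHardCoreConfig (EuclideanSpace ℝ (Fin 3)) δ × EuclideanSpace ℝ (Fin 3) =>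
          w p.2 + (1 - ∫⁻ z, w z ∂((p.1.1 : LocalConfig (EuclideanSpace ℝ (Fin 3))).toMeasure)) *
            ({(0 : EuclideanSpace ℝ (Fin 3))} : Set (EuclideanSpace ℝ (Fin 3))).indicator
              (fun _ => (1 : ℝ≥0∞)) p.2))),
      f ((fun p : RootedHardCoreConfig (EuclideanSpace ℝ (Fin 3)) δ × EuclideanSpace ℝ (Fin 3) =>
        ((if h : p.2 ∈ ((p.1.1 : LocalConfig (EuclideanSpace ℝ (Fin 3))) : Set (EuclideanSpace ℝ (Fin 3)))
          then p.1.reroot p.2 h else p.1 : RootedHardCoreConfig (EuclideanSpace ℝ (Fin 3)) δ), -p.2)) q).1 = f q.1) :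
    ∃ f' : RootedHardCoreConfig (EuclideanSpace ℝ (Fin 3)) δ → β, Measurable f' ∧ f' =ᵐ[ν] f ∧
      ∀ (S : RootedHardCoreConfig (EuclideanSpace ℝ (Fin 3)) δ) (y : EuclideanSpace ℝ (Fin 3))
        (hy : y ∈ ((S.1 : LocalConfig (EuclideanSpace ℝ (Fin 3))) : Set (EuclideanSpace ℝ (Fin 3)))),
        f' (S.reroot y hy) = f' S :=
  exists_invariant_ae_eq hinv hf ((ae_campbell_iff ν hw hw0).1 hae)

end Summit.AtomisticToContinuum.Crystallization.Theorems.FrustratedLawDichotomyErgodicReduction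

end
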